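import Summits.AtomisticToContinuum.HydrodynamicLimit.Theorems.BoxDissipativeWeakStrongFluxClosureOfParts
import Summits.AtomisticToContinuum.HydrodynamicLimit.Theorems.BoxDissipativeWeakStrongFluxClosureCollisionalVirialTight
import Summits.AtomisticToContinuum.HydrodynamicLimit.Theorems.BoxDissipativeWeakStrongLocalGibbsFineScaleStaticsMain
import HarnessLib

/-!
# Crux `FluxClosure` (stmt-AtomisticToContinuum-9902, route BoxDissipativeWeakStrong), line `registered`:
# rung-0 piece E5 (cut-pressure term in global equilibrium) — generic lemmas

Support file (`--supports stmt-AtomisticToContinuum-9902`) of the continuation lead's RUNG-0 PROGRAMME (constant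
profiles, law `P_N = localGibbsLaw σ a u θ N (Φ N)`); helper lemmas of the registered stub `homogeneous_pressureTerm`
(file `…FluxClosureEqHomPressure.lean`), whose last theorem is itself registered (`E5_localGibbsLaw_const_univ_le_one`):

* (A) the POINTWISE LEMMA behind the `L¹(P_N)` convergence of the cut pressure `p_cut = ρ̂θ̂ Z(min(ρ̂σ³, η₁))`,
  `ρ̂θ̂ = ⅔Ê − |m̂|²/(3ρ̂)`: with `d = m̂ − ρ̂u`, `|m̂|²/ρ̂ − c₀|u|² = |d|²/ρ̂ + 2⟨d,u⟩ + (ρ̂ − c₀)|u|²` and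
  `|d|²/ρ̂ ≤ |d| + |H − H∞| + |H∞|(2/c₀)(|ρ̂ − c₀| + |d|)` (`H = 4Ê + 2ρ̂|u|²`, Cauchy–Schwarz `|m̂|² ≤ 2ρ̂Ê`), whence
  `|ρ̂θ̂ Z(·) − c₀θ Z(·)| ≤ L (|ρ̂ − c₀| + ‖m̂ − c₀u‖ + |Ê − E(c₀,u,θ)|) + |c₀θ| κ` for an explicit `L`
  (`E5_sq_norm_div_le`, `E5_abs_boxq_sub_le`, `E5_abs_cutPressure_sub_le`);
* (B) `|Z(min(rσ³,η₁))| ≤ Z_max` and the continuity modulus of `r ↦ Z(min(rσ³,η₁))` at `c₀ > 0` when `Z` is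
  continuous on `[0, η₁]` (`E5_abs_cutZ_le`, `E5_cutZ_modulus`);
* the frozen-configuration facts `0 ≤ ρ̂`, `|m̂|² ≤ 2ρ̂Ê`, `|ρ̂θ̂| ≤ ⅔Ê` (`E5_box_facts`, from `DeviatoricStressClosure`);
* Tonelli measurability of `z ↦ ∫⁻ₓ F(Φ_t z, x)` and of `(z,t) ↦ ∫⁻ₓ F(Φ_t z, x)` for laws carried by the good set
  (`E5_measurable_lintegral_comp_flow`, `E5_aemeasurable_lintegral_comp_flow_prod`);
* `P_N(univ) ≤ 1` for the rung-0 local Gibbs law with NO hypothesis on `a, θ, σ` (`E5_localGibbsLaw_const_univ_le_one`: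
  the density is `(∫ C h)⁻¹ (C h)` with `h ≥ 0`).

No definitions. References: H. Spohn, *Large Scale Dynamics of Interacting Particles* (1991), Part I §2.3, §3.3.
-/

noncomputable section

namespace Summit.AtomisticToContinuum.HydrodynamicLimit.Theorems
namespace FluxClosureEq
namespace E5

open scoped BigOperators Topology Classical MeasureTheory ProbabilityTheory InnerProductSpace ENNReal
open Filter Set Function MeasureTheory
open Literature.MathematicalPhysics.KineticTheory Literature.Analysis.FluidPDE Literature.Analysis.FunctionSpaces
open Summit.AtomisticToContinuum.HydrodynamicLimit.Theses.BoxDissipativeWeakStrong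

/-! ### (A) The pointwise lemma: pure real analysis -/

/-- **Control of `|d|²/r`, `d = m − r u`.** For `r > 0`, `c > 0`, `‖m‖² ≤ 2 r E` and any reference value
`H∞`: `‖d‖²/r ≤ ‖d‖ + |4E + 2r‖u‖² − H∞| + |H∞| ((2/c)|r − c| + (2/c)‖d‖)` (if `‖d‖ ≤ r` the left side is
`≤ ‖d‖`; otherwise it is `≤ 4E + 2r‖u‖²` and `1 ≤ (2/c)|r − c| + (2/c)‖d‖`). [folklore] -/
theorem E5_sq_norm_div_le {r c E Hinf : ℝ} {m u : V3} (hr : 0 < r) (hc : 0 < c)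
    (hmE : ‖m‖ ^ 2 ≤ 2 * r * E) :
    ‖m - r • u‖ ^ 2 / r ≤ ‖m - r • u‖ + |4 * E + 2 * r * ‖u‖ ^ 2 - Hinf| +
      |Hinf| * (2 / c * |r - c| + 2 / c * ‖m - r • u‖) := by
  set nd : ℝ := ‖m - r • u‖ with hnd
  have hnd0 : 0 ≤ nd := norm_nonneg _
  have hfac0 : 0 ≤ 2 / c * |r - c| + 2 / c * nd := by positivity
  have hrest0 : 0 ≤ |4 * E + 2 * r * ‖u‖ ^ 2 - Hinf| + |Hinf| * (2 / c * |r - c| + 2 / c * nd) := by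
    positivity
  by_cases hd : nd ≤ r
  · have h1 : nd ^ 2 / r ≤ nd := by
      rw [div_le_iff₀ hr, sq]
      exact mul_le_mul_of_nonneg_left hd hnd0
    linarith
  · have hd : r < nd := not_le.mp hd
    -- `‖d‖² ≤ 2‖m‖² + 2 r² ‖u‖² ≤ 4 r E + 2 r² ‖u‖²`
    have hru : ‖r • u‖ = r * ‖u‖ := by rw [norm_smul, Real.norm_eq_abs, abs_of_pos hr]
    have h2 : nd ≤ ‖m‖ + r * ‖u‖ := by rw [hnd, ← hru]; exact norm_sub_le _ _
    have h3 : nd ^ 2 ≤ 2 * ‖m‖ ^ 2 + 2 * (r * ‖u‖) ^ 2 := by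
      have h := pow_le_pow_left₀ hnd0 h2 2
      nlinarith [sq_nonneg (‖m‖ - r * ‖u‖)]
    have h4 : nd ^ 2 / r ≤ 4 * E + 2 * r * ‖u‖ ^ 2 := by
      rw [div_le_iff₀ hr]
      nlinarith
    -- `1 ≤ (2/c)|r - c| + (2/c)‖d‖`
    have h5 : 1 ≤ 2 / c * |r - c| + 2 / c * nd := by
      by_cases hrc : r < c / 2
      · have h6 : c / 2 ≤ |r - c| := by
          rw [abs_sub_comm, abs_of_pos (by linarith)]
          linarith
        have h7 : 1 ≤ 2 / c * |r - c| := by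
          rw [div_mul_eq_mul_div, le_div_iff₀ hc]
          linarith
        linarith [mul_nonneg (div_nonneg zero_le_two hc.le) hnd0]
      · have hrc : c / 2 ≤ r := not_lt.mp hrc
        have h7 : 1 ≤ 2 / c * nd := by
          rw [div_mul_eq_mul_div, le_div_iff₀ hc]
          linarith
        linarith [mul_nonneg (div_nonneg zero_le_two hc.le) (abs_nonneg (r - c))]
    have h8 : 4 * E + 2 * r * ‖u‖ ^ 2 ≤ |4 * E + 2 * r * ‖u‖ ^ 2 - Hinf| +
        |Hinf| * (2 / c * |r - c| + 2 / c * nd) := by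
      have h9 : |Hinf| ≤ |Hinf| * (2 / c * |r - c| + 2 / c * nd) :=
        le_mul_of_one_le_right (abs_nonneg _) h5
      linarith [le_abs_self (4 * E + 2 * r * ‖u‖ ^ 2 - Hinf), le_abs_self Hinf]
    linarith

/-- **The pointwise lemma for `q = ρ̂θ̂`** (`r > 0`): for `c > 0`, `‖m‖² ≤ 2 r E`,
`|r·⅔(E/r − ‖m‖²/(2r²)) − cθ| ≤ L₁ (|r − c| + ‖m − c u‖ + |E − E₀|)`, `E₀ = totalEnergyDensity c u θ`, with the
explicit constant `L₁ = 2 + W(1 + ‖u‖) + ‖u‖² + 2|H∞|/c`, `W = 1 + 2‖u‖ + 2|H∞|/c`, `H∞ = 4E₀ + 2c‖u‖²`. [folklore] -/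
theorem E5_abs_boxq_sub_le {r c E θ : ℝ} {m u : V3} (hr : 0 < r) (hc : 0 < c)
    (hmE : ‖m‖ ^ 2 ≤ 2 * r * E) :
    |r * (2 / 3 * (E / r - ‖m‖ ^ 2 / (2 * r ^ 2))) - c * θ| ≤
      (2 + (1 + 2 * ‖u‖ + 2 * |4 * totalEnergyDensity c u θ + 2 * c * ‖u‖ ^ 2| / c) * (1 + ‖u‖) + ‖u‖ ^ 2 +
          2 * |4 * totalEnergyDensity c u θ + 2 * c * ‖u‖ ^ 2| / c) *
        (|r - c| + ‖m - c • u‖ + |E - totalEnergyDensity c u θ|) := by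
  set E₀ : ℝ := totalEnergyDensity c u θ with hE₀
  set U : ℝ := ‖u‖ with hU
  set Hinf : ℝ := 4 * E₀ + 2 * c * U ^ 2 with hHinf
  set A : ℝ := 2 * |Hinf| / c with hA
  set d : V3 := m - r • u with hd
  set nd : ℝ := ‖d‖ with hnd
  set δr : ℝ := |r - c| with hδr
  set δm : ℝ := ‖m - c • u‖ with hδm
  set δE : ℝ := |E - E₀| with hδE
  have hU0 : 0 ≤ U := norm_nonneg _
  have hA0 : 0 ≤ A := by positivity
  have hnd0 : 0 ≤ nd := norm_nonneg _
  have hδr0 : 0 ≤ δr := abs_nonneg _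
  have hδm0 : 0 ≤ δm := norm_nonneg _
  have hδE0 : 0 ≤ δE := abs_nonneg _
  have hr0 : r ≠ 0 := hr.ne'
  -- the algebra
  have hq : r * (2 / 3 * (E / r - ‖m‖ ^ 2 / (2 * r ^ 2))) = 2 / 3 * E - ‖m‖ ^ 2 / r / 3 := by
    field_simp
  have hm : m = d + r • u := by rw [hd, sub_add_cancel]
  have hm2 : ‖m‖ ^ 2 = nd ^ 2 + 2 * r * inner ℝ d u + r ^ 2 * U ^ 2 := by
    rw [hm, norm_add_sq_real, real_inner_smul_right, norm_smul, Real.norm_eq_abs, abs_of_pos hr, hnd, hU]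
    ring
  have hkey : ‖m‖ ^ 2 / r = nd ^ 2 / r + 2 * inner ℝ d u + r * U ^ 2 := by
    rw [hm2]
    field_simp
  have hθ : c * θ = 2 / 3 * E₀ - c * U ^ 2 / 3 := by
    rw [hE₀, totalEnergyDensity, hU]
    ring
  have hdiff : r * (2 / 3 * (E / r - ‖m‖ ^ 2 / (2 * r ^ 2))) - c * θ =
      2 / 3 * (E - E₀) - (nd ^ 2 / r + 2 * inner ℝ d u + (r - c) * U ^ 2) / 3 := by
    rw [hq, hθ, hkey]
    ring
  -- the bounds
  have hip : |inner ℝ d u| ≤ nd * U := abs_real_inner_le_norm _ _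
  have hX := E5_sq_norm_div_le (Hinf := Hinf) (u := u) hr hc hmE
  rw [← hd, ← hnd] at hX
  have hH : |4 * E + 2 * r * ‖u‖ ^ 2 - Hinf| ≤ 4 * δE + 2 * U ^ 2 * δr := by
    rw [← hU, hHinf]
    calc |4 * E + 2 * r * U ^ 2 - (4 * E₀ + 2 * c * U ^ 2)| = |4 * (E - E₀) + 2 * U ^ 2 * (r - c)| := by
          ring_nf
      _ ≤ |4 * (E - E₀)| + |2 * U ^ 2 * (r - c)| := abs_add_le _ _
      _ = 4 * δE + 2 * U ^ 2 * δr := by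
          rw [abs_mul, abs_mul, abs_of_pos (by norm_num : (0 : ℝ) < 4), hδE, hδr,
            abs_of_nonneg (by positivity : (0 : ℝ) ≤ 2 * U ^ 2)]
  have hndle : nd ≤ δm + U * δr := by
    have h : d = (m - c • u) + (c - r) • u := by rw [hd, sub_smul]; abel
    calc nd = ‖(m - c • u) + (c - r) • u‖ := by rw [hnd, h]
      _ ≤ ‖m - c • u‖ + ‖(c - r) • u‖ := norm_add_le _ _
      _ = δm + U * δr := by rw [norm_smul, Real.norm_eq_abs, abs_sub_comm, hδm, hδr, hU]; ring
  have hX' : nd ^ 2 / r ≤ nd + (4 * δE + 2 * U ^ 2 * δr) + |Hinf| * (2 / c * δr + 2 / c * nd) := by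
    linarith
  have hXA : |Hinf| * (2 / c * δr + 2 / c * nd) = A * δr + A * nd := by rw [hA]; ring
  rw [hXA] at hX'
  -- `|q - cθ| ≤ 2/3 δE + (X + 2 nd U + δr U²)/3`
  have hX0 : 0 ≤ nd ^ 2 / r := by positivity
  have h1 : |r * (2 / 3 * (E / r - ‖m‖ ^ 2 / (2 * r ^ 2))) - c * θ| ≤
      2 / 3 * δE + (nd ^ 2 / r + 2 * (nd * U) + δr * U ^ 2) / 3 := by
    rw [hdiff]
    calc |2 / 3 * (E - E₀) - (nd ^ 2 / r + 2 * inner ℝ d u + (r - c) * U ^ 2) / 3|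
        ≤ |2 / 3 * (E - E₀)| + |(nd ^ 2 / r + 2 * inner ℝ d u + (r - c) * U ^ 2) / 3| := abs_sub _ _
      _ ≤ 2 / 3 * δE + (nd ^ 2 / r + 2 * (nd * U) + δr * U ^ 2) / 3 := by
          refine add_le_add (by rw [abs_mul, abs_of_pos (by norm_num : (0 : ℝ) < 2 / 3), hδE]) ?_
          rw [abs_div, abs_of_pos (by norm_num : (0 : ℝ) < 3), div_le_div_iff_of_pos_right (by norm_num : (0 : ℝ) < 3)]
          calc |nd ^ 2 / r + 2 * inner ℝ d u + (r - c) * U ^ 2|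
              ≤ |nd ^ 2 / r + 2 * inner ℝ d u| + |(r - c) * U ^ 2| := abs_add_le _ _
            _ ≤ (|nd ^ 2 / r| + |2 * inner ℝ d u|) + |(r - c) * U ^ 2| := add_le_add (abs_add_le _ _) le_rfl
            _ ≤ (nd ^ 2 / r + 2 * (nd * U)) + δr * U ^ 2 := by
                rw [abs_of_nonneg hX0, abs_mul, abs_of_pos (by norm_num : (0 : ℝ) < 2), abs_mul, hδr,
                  abs_of_nonneg (sq_nonneg U)]
                linarith
  -- multiply the `nd`-bounds by their (nonnegative) coefficients and add up
  have h2 : U * nd ≤ U * (δm + U * δr) := mul_le_mul_of_nonneg_left hndle hU0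
  have h3 : A * nd ≤ A * (δm + U * δr) := mul_le_mul_of_nonneg_left hndle hA0
  linarith [h1, hX', h2, h3, hndle, hδr0, hδm0, hδE0, hnd0, (by positivity : 0 ≤ U * δr),
    (by positivity : 0 ≤ U ^ 2 * δr), (by positivity : 0 ≤ A * δr), (by positivity : 0 ≤ A * U * δr),
    (by positivity : 0 ≤ U * δm), (by positivity : 0 ≤ U ^ 2 * δm), (by positivity : 0 ≤ A * δm),
    (by positivity : 0 ≤ A * U * δm), (by positivity : 0 ≤ U * δE), (by positivity : 0 ≤ U ^ 2 * δE),
    (by positivity : 0 ≤ A * δE), (by positivity : 0 ≤ A * U * δE)]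

/-- **The pointwise lemma for the cut pressure.** For `c > 0`, `Z_max ≥ 0`, `κ ≥ 0`, `ϑ > 0`, a function `g`
with `|g r| ≤ Z_max` (`r ≥ 0`) and `|g r − g c| ≤ κ` whenever `|r − c| < ϑ`, and box data `r ≥ 0`, `m`, `E` with
`‖m‖² ≤ 2 r E`: `|r θ̂(r,m,E) g(r) − c θ̂(c, cu, E(c,u,θ)) g(c)| ≤ L (|r − c| + ‖m − cu‖ + |E − E(c,u,θ)|) + |cθ| κ`
with an explicit `L = L(c, θ, u, Z_max, ϑ) ≥ 0` (`c θ̂(c, cu, E(c,u,θ)) = cθ`; `|g r − g c| ≤ κ + (2Z_max/ϑ)|r − c|`;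
`E5_abs_boxq_sub_le` for `r > 0`, and `|cθ g(c)| ≤ Z_max|θ| |0 − c|` for the empty box `r = 0`). [folklore] -/
theorem E5_abs_cutPressure_sub_le {c θ Zmax κ ϑ : ℝ} {u : V3} {g : ℝ → ℝ} (hc : 0 < c) (hZ0 : 0 ≤ Zmax)
    (hκ : 0 ≤ κ) (hϑ : 0 < ϑ) (hgb : ∀ r, 0 ≤ r → |g r| ≤ Zmax) (hgc : ∀ r, |r - c| < ϑ → |g r - g c| ≤ κ)
    {r E : ℝ} {m : V3} (hr : 0 ≤ r) (hmE : ‖m‖ ^ 2 ≤ 2 * r * E) :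
    |r * (2 / 3 * (E / r - ‖m‖ ^ 2 / (2 * r ^ 2))) * g r -
        c * (2 / 3 * (totalEnergyDensity c u θ / c - ‖c • u‖ ^ 2 / (2 * c ^ 2))) * g c| ≤
      Zmax * ((2 + (1 + 2 * ‖u‖ + 2 * |4 * totalEnergyDensity c u θ + 2 * c * ‖u‖ ^ 2| / c) * (1 + ‖u‖) +
          ‖u‖ ^ 2 + 2 * |4 * totalEnergyDensity c u θ + 2 * c * ‖u‖ ^ 2| / c) + 2 * |c * θ| / ϑ + |θ|) *
        (|r - c| + ‖m - c • u‖ + |E - totalEnergyDensity c u θ|) + |c * θ| * κ := by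
  set L₁ : ℝ := 2 + (1 + 2 * ‖u‖ + 2 * |4 * totalEnergyDensity c u θ + 2 * c * ‖u‖ ^ 2| / c) * (1 + ‖u‖) +
    ‖u‖ ^ 2 + 2 * |4 * totalEnergyDensity c u θ + 2 * c * ‖u‖ ^ 2| / c with hL₁
  have hL₁0 : 0 ≤ L₁ := by positivity
  have hq0 : c * (2 / 3 * (totalEnergyDensity c u θ / c - ‖c • u‖ ^ 2 / (2 * c ^ 2))) = c * θ := by
    rw [totalEnergyDensity, norm_smul, mul_pow, Real.norm_eq_abs, sq_abs]
    field_simp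
    ring
  rw [hq0]
  rcases hr.eq_or_lt with h0 | hpos
  · -- empty box: `r = 0`
    subst h0
    set S : ℝ := |0 - c| + ‖m - c • u‖ + |E - totalEnergyDensity c u θ| with hS
    have hcS : c ≤ S := by
      rw [hS, zero_sub, abs_neg, abs_of_pos hc]
      linarith [norm_nonneg (m - c • u), abs_nonneg (E - totalEnergyDensity c u θ)]
    have hS0 : 0 ≤ S := hc.le.trans hcS
    have e1 : 0 ≤ Zmax * (L₁ + 2 * |c * θ| / ϑ) * S := by positivity
    have e2 : 0 ≤ |c * θ| * κ := by positivity
    calc |0 * (2 / 3 * (E / 0 - ‖m‖ ^ 2 / (2 * 0 ^ 2))) * g 0 - c * θ * g c| = |c * θ| * |g c| := by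
          rw [zero_mul, zero_mul, zero_sub, abs_neg, abs_mul]
      _ ≤ |c * θ| * Zmax := mul_le_mul_of_nonneg_left (hgb c hc.le) (abs_nonneg _)
      _ = Zmax * |θ| * c := by rw [abs_mul, abs_of_pos hc]; ring
      _ ≤ Zmax * |θ| * S := mul_le_mul_of_nonneg_left hcS (by positivity)
      _ ≤ Zmax * (L₁ + 2 * |c * θ| / ϑ + |θ|) * S + |c * θ| * κ := by linarith
  · -- occupied box: `r > 0`
    set S : ℝ := |r - c| + ‖m - c • u‖ + |E - totalEnergyDensity c u θ| with hS
    have hS0 : 0 ≤ S := by positivity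
    have hδrS : |r - c| ≤ S := by
      rw [hS]; linarith [norm_nonneg (m - c • u), abs_nonneg (E - totalEnergyDensity c u θ)]
    have hq : |r * (2 / 3 * (E / r - ‖m‖ ^ 2 / (2 * r ^ 2))) - c * θ| ≤ L₁ * S :=
      E5_abs_boxq_sub_le (θ := θ) (u := u) hpos hc hmE
    have hgr : |g r| ≤ Zmax := hgb r hr
    have hgd : |g r - g c| ≤ κ + 2 * Zmax / ϑ * |r - c| := by
      by_cases h : |r - c| < ϑ
      · have h1 := hgc r h
        have h2 : 0 ≤ 2 * Zmax / ϑ * |r - c| := by positivity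
        linarith
      · have h' : ϑ ≤ |r - c| := not_lt.mp h
        have h1 : |g r - g c| ≤ 2 * Zmax := (abs_sub _ _).trans (by linarith [hgb c hc.le])
        have h2 : 2 * Zmax ≤ 2 * Zmax / ϑ * |r - c| := by
          rw [div_mul_eq_mul_div, le_div_iff₀ hϑ]
          exact mul_le_mul_of_nonneg_left h' (by positivity)
        linarith
    have key : |c * θ| * (2 * Zmax / ϑ * |r - c|) ≤ Zmax * (2 * |c * θ| / ϑ) * S :=
      calc |c * θ| * (2 * Zmax / ϑ * |r - c|) = Zmax * (2 * |c * θ| / ϑ) * |r - c| := by ring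
        _ ≤ Zmax * (2 * |c * θ| / ϑ) * S := mul_le_mul_of_nonneg_left hδrS (by positivity)
    have key2 : 0 ≤ Zmax * |θ| * S := by positivity
    calc |r * (2 / 3 * (E / r - ‖m‖ ^ 2 / (2 * r ^ 2))) * g r - c * θ * g c|
        = |(r * (2 / 3 * (E / r - ‖m‖ ^ 2 / (2 * r ^ 2))) - c * θ) * g r + c * θ * (g r - g c)| := by ring_nf
      _ ≤ |(r * (2 / 3 * (E / r - ‖m‖ ^ 2 / (2 * r ^ 2))) - c * θ) * g r| + |c * θ * (g r - g c)| :=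
          abs_add_le _ _
      _ = |r * (2 / 3 * (E / r - ‖m‖ ^ 2 / (2 * r ^ 2))) - c * θ| * |g r| + |c * θ| * |g r - g c| := by
          rw [abs_mul, abs_mul]
      _ ≤ L₁ * S * Zmax + |c * θ| * (κ + 2 * Zmax / ϑ * |r - c|) :=
          add_le_add (mul_le_mul hq hgr (abs_nonneg _) (by positivity)) (mul_le_mul_of_nonneg_left hgd (abs_nonneg _))
      _ ≤ Zmax * (L₁ + 2 * |c * θ| / ϑ + |θ|) * S + |c * θ| * κ := by linarith

/-! ### (B) The cut compressibility factor `r ↦ Z(min(rσ³, η₁))` -/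

/-- `|Z(min(rσ³, η₁))| ≤ Z_max` for `r ≥ 0` (`σ, η₁ ≥ 0`: the argument lies in `[0, η₁]`). [folklore] -/
theorem E5_abs_cutZ_le {σ η₁ Zmax : ℝ} (hσ : 0 ≤ σ) (hη₁ : 0 ≤ η₁)
    (hZ : ∀ η ∈ Icc 0 η₁, |hsCompressibility η| ≤ Zmax) (r : ℝ) (hr : 0 ≤ r) :
    |hsCompressibility (min (r * σ ^ 3) η₁)| ≤ Zmax :=
  hZ _ ⟨le_min (mul_nonneg hr (pow_nonneg hσ 3)) hη₁, min_le_right _ _⟩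

/-- **Continuity of the cut compressibility at `c₀ > 0`**: if `Z` is continuous on `[0, η₁]` then for every
`κ > 0` there is `ϑ > 0` with `|Z(min(rσ³,η₁)) − Z(min(c₀σ³,η₁))| ≤ κ` whenever `|r − c₀| < ϑ` (the map
`r ↦ min(rσ³, η₁)` is continuous and sends `[0, ∞)` into `[0, η₁]`, a neighbourhood statement at `c₀ > 0`). [folklore] -/
theorem E5_cutZ_modulus {σ η₁ c₀ κ : ℝ} (hσ : 0 ≤ σ) (hη₁ : 0 ≤ η₁) (hc₀ : 0 < c₀)
    (hZc : ContinuousOn hsCompressibility (Icc 0 η₁)) (hκ : 0 < κ) :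
    ∃ ϑ : ℝ, 0 < ϑ ∧ ∀ r, |r - c₀| < ϑ →
      |hsCompressibility (min (r * σ ^ 3) η₁) - hsCompressibility (min (c₀ * σ ^ 3) η₁)| ≤ κ := by
  have hφ : Continuous fun r : ℝ => min (r * σ ^ 3) η₁ := (continuous_id.mul continuous_const).min continuous_const
  have hmaps : MapsTo (fun r : ℝ => min (r * σ ^ 3) η₁) (Ici 0) (Icc 0 η₁) := fun r hr =>
    ⟨le_min (mul_nonneg hr (pow_nonneg hσ 3)) hη₁, min_le_right _ _⟩
  have hg : ContinuousOn (fun r => hsCompressibility (min (r * σ ^ 3) η₁)) (Ici 0) :=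
    hZc.comp hφ.continuousOn hmaps
  have hga : ContinuousAt (fun r => hsCompressibility (min (r * σ ^ 3) η₁)) c₀ :=
    hg.continuousAt (Ici_mem_nhds hc₀)
  obtain ⟨ϑ, hϑ, h⟩ := Metric.continuousAt_iff.1 hga κ hκ
  refine ⟨ϑ, hϑ, fun r hr => ?_⟩
  have h' := h (x := r) (by rwa [Real.dist_eq])
  rw [Real.dist_eq] at h'
  exact h'.le

/-! ### Box fields at a frozen configuration -/

/-- At a frozen configuration, for a weight `χ ≥ 0`: `0 ≤ ρ̂`, `0 ≤ Ê`, Cauchy–Schwarz `‖m̂‖² ≤ 2ρ̂Ê` and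
`|ρ̂θ̂| ≤ ⅔Ê` (`DeviatoricStressClosure`, freed from the translate form of the weight). [folklore] -/
theorem E5_box_facts {n : ℕ} (c : Config n (Fin 3) T3) (x : T3) {χ : T3 → ℝ} (hχ : ∀ y, 0 ≤ χ y) :
    0 ≤ empiricalDensityField c χ ∧ 0 ≤ empiricalEnergyField c χ ∧
      ‖empiricalMomentumField c χ‖ ^ 2 ≤ 2 * empiricalDensityField c χ * empiricalEnergyField c χ ∧
      |empiricalDensityField c χ * (2 / 3 * (empiricalEnergyField c χ / empiricalDensityField c χ -
        ‖empiricalMomentumField c χ‖ ^ 2 / (2 * empiricalDensityField c χ ^ 2)))| ≤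
        2 / 3 * empiricalEnergyField c χ := by
  have hR : empiricalDensityField c χ = empiricalDensityField c (fun y => (fun u => χ (x - u)) (x - y)) := by
    rw [← FluxClosureK.weight_eq_translate χ x]
  have hMv : empiricalMomentumField c χ = empiricalMomentumField c (fun y => (fun u => χ (x - u)) (x - y)) := by
    rw [← FluxClosureK.weight_eq_translate χ x]
  have hEn : empiricalEnergyField c χ = empiricalEnergyField c (fun y => (fun u => χ (x - u)) (x - y)) := by
    rw [← FluxClosureK.weight_eq_translate χ x]
  obtain ⟨hR0, hEn0, -, h2⟩ :=
    DeviatoricStressClosure.abs_reynolds_le_and_abs_pressure_le c x (k := fun u => χ (x - u)) (fun y => hχ _) hR hMv hEn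
  exact ⟨hR0, hEn0,
    DeviatoricStressClosure.norm_sq_momentum_le c x (k := fun u => χ (x - u)) (fun y => hχ _) hR hMv hEn, h2⟩

/-! ### Measurability along the flow -/

/-- For a jointly measurable `F(z, x) ≥ 0` and a fixed time `t`, `z ↦ ∫⁻ₓ F(Φ_t z, x)` is measurable
(`Φ_t` is measurable; Tonelli measurability). [folklore] -/
theorem E5_measurable_lintegral_comp_flow {n : ℕ} {ε : ℝ} (Φ : HardSphereFlow (Torus.geometry (Fin 3)) ε n)
    {F : Config n (Fin 3) T3 × T3 → ℝ≥0∞} (hF : Measurable F) (t : ℝ) :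
    Measurable fun z : Config n (Fin 3) T3 => ∫⁻ x, F (Φ.flow t z, x) :=
  (hF.comp (((Φ.measurable_flow t).comp measurable_fst).prodMk measurable_snd)).lintegral_prod_right'

/-- For a jointly measurable `F(z, x) ≥ 0`, a law `μ` carried by the good set and an s-finite `ν` on `ℝ`,
`(z, t) ↦ ∫⁻ₓ F(Φ_t z, x)` is a.e.-measurable for `μ ⊗ ν` (the flow is jointly measurable on `good × ℝ`,
`HardSphereFlow.measurable_flow_prod_torus`; `μ ⊗ ν` is carried by `good × ℝ`). [folklore] -/
theorem E5_aemeasurable_lintegral_comp_flow_prod {n : ℕ} {ε : ℝ}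
    (Φ : HardSphereFlow (Torus.geometry (Fin 3)) ε n) {F : Config n (Fin 3) T3 × T3 → ℝ≥0∞} (hF : Measurable F)
    {μ : Measure (Config n (Fin 3) T3)} [SFinite μ] (hμ : μ Φ.goodᶜ = 0) (ν : Measure ℝ) [SFinite ν] :
    AEMeasurable (fun p : Config n (Fin 3) T3 × ℝ => ∫⁻ x, F (Φ.flow p.2 p.1, x)) (μ.prod ν) := by
  set s : Set (Config n (Fin 3) T3 × ℝ) := Prod.fst ⁻¹' Φ.good with hs_def
  have hs : MeasurableSet s := measurable_fst Φ.measurableSet_good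
  have h1 : Measurable fun q : (Φ.good × ℝ) × T3 => F (Φ.flow q.1.2 (q.1.1 : Config n (Fin 3) T3), q.2) :=
    hF.comp ((Φ.measurable_flow_prod_torus.comp measurable_fst).prodMk measurable_snd)
  have h2 : Measurable fun q : Φ.good × ℝ => ∫⁻ x, F (Φ.flow q.2 (q.1 : Config n (Fin 3) T3), x) :=
    h1.lintegral_prod_right'
  have h3 : Measurable fun p : s => ∫⁻ x, F (Φ.flow (p : Config n (Fin 3) T3 × ℝ).2 (p : Config n (Fin 3) T3 × ℝ).1, x) :=
    h2.comp (((measurable_fst.comp measurable_subtype_coe).subtype_mk (h := fun p : s => p.2)).prodMk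
      (measurable_snd.comp measurable_subtype_coe))
  have hae : ∀ᵐ p ∂(μ.prod ν), p ∈ s := by
    rw [ae_iff]
    have : {p : Config n (Fin 3) T3 × ℝ | ¬p ∈ s} = Φ.goodᶜ ×ˢ (univ : Set ℝ) := by
      ext p
      simp [hs_def]
    rw [this, Measure.prod_prod, hμ, zero_mul]
  have h4 := aemeasurable_restrict_of_measurable_subtype (μ := μ.prod ν)
    (f := fun p : Config n (Fin 3) T3 × ℝ => ∫⁻ x, F (Φ.flow p.2 p.1, x)) hs h3
  rwa [Measure.restrict_eq_self_of_ae_mem hae] at h4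

/-! ### The rung-0 local Gibbs law is a sub-probability, for ALL parameters -/

/-- A normalised density `(∫ C h)⁻¹ (C h)` with `h ≥ 0` (Bochner integral, junk value `0`) has lower integral
at most one: `(C ∫h)⁻¹ C h ≤ (∫h)⁻¹ h` pointwise, and `∫⁻ (∫h)⁻¹ h ∈ {0, 1}`. [folklore] -/
theorem E5_lintegral_ofReal_inv_integral_mul_le_one {α : Type*} [MeasurableSpace α] (μ : Measure α)
    {h : α → ℝ} (hh : ∀ x, 0 ≤ h x) (C : ℝ) :
    ∫⁻ x, ENNReal.ofReal ((∫ y, C * h y ∂μ)⁻¹ * (C * h x)) ∂μ ≤ 1 := by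
  rw [integral_const_mul]
  have hI0 : 0 ≤ ∫ y, h y ∂μ := integral_nonneg hh
  have hpt : ∀ x, (C * ∫ y, h y ∂μ)⁻¹ * (C * h x) ≤ (∫ y, h y ∂μ)⁻¹ * h x := by
    intro x
    rw [mul_inv, mul_mul_mul_comm]
    rcases eq_or_ne C 0 with hC | hC
    · rw [hC, mul_zero, zero_mul]
      exact mul_nonneg (inv_nonneg.2 hI0) (hh x)
    · rw [inv_mul_cancel₀ hC, one_mul]
  calc ∫⁻ x, ENNReal.ofReal ((C * ∫ y, h y ∂μ)⁻¹ * (C * h x)) ∂μ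
      ≤ ∫⁻ x, ENNReal.ofReal ((∫ y, h y ∂μ)⁻¹ * h x) ∂μ := lintegral_mono fun x => ENNReal.ofReal_le_ofReal (hpt x)
    _ ≤ 1 := by
      by_cases hint : Integrable h μ
      · rw [← ofReal_integral_eq_lintegral_ofReal (hint.const_mul _)
            (ae_of_all _ fun x => mul_nonneg (inv_nonneg.2 hI0) (hh x)), integral_const_mul, ← ENNReal.ofReal_one]
        refine ENNReal.ofReal_le_ofReal ?_
        rcases hI0.eq_or_lt with h0 | hpos
        · rw [← h0, inv_zero, zero_mul]; exact zero_le_one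
        · rw [inv_mul_cancel₀ hpos.ne']
      · simp [integral_undef hint]

/-- **`P_N(univ) ≤ 1` for the rung-0 local Gibbs law, with no hypothesis on `a, θ, σ`**: the density is
`Z⁻¹ 𝟙_D (a M_{1,u,θ})^{⊗(N+1)} = (∫ C h)⁻¹ (C h)` with `C = (a (2πθ)^{-3/2})^{N+1}` and
`h = 𝟙_D ∏ᵢ exp(−|vᵢ − u|²/2θ) ≥ 0`. [folklore] -/
theorem E5_localGibbsLaw_const_univ_le_one : ∀ (σ a θ : ℝ) (u : V3) (N : ℕ) (Φ : HardSphereFlow (Torus.geometry (Fin 3)) (hsDiameter σ N) (N + 1)), localGibbsLaw σ (fun _ => a) (fun _ => u) (fun _ => θ) N Φ univ ≤ 1 := by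
  intro σ a θ u N Φ
  rw [localGibbsLaw_eq, localGibbsMeasure, withDensity_apply _ MeasurableSet.univ, Measure.restrict_univ]
  simp only [canonicalDensity, canonicalPartition]
  set D : Set (Config (N + 1) (Fin 3) T3) := hardSphereDomain (Torus.geometry (Fin 3)) (N + 1) (hsDiameter σ N)
    with hDdef
  set h : Config (N + 1) (Fin 3) T3 → ℝ := D.indicator fun z => ∏ i, Real.exp (-‖(z i).2 - u‖ ^ 2 / (2 * θ))
    with hhdef
  have hh : ∀ z, 0 ≤ h z := fun z =>
    Set.indicator_nonneg (fun w _ => Finset.prod_nonneg fun i _ => (Real.exp_pos _).le) z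
  obtain ⟨C, heq⟩ : ∃ C : ℝ, D.indicator (tensorPow (N + 1) (localGibbsProfile (fun _ => a) (fun _ => u) (fun _ => θ))) =
      fun z => C * h z := by
    refine ⟨(a * ((1 : ℝ) * (2 * Real.pi * θ) ^ (-(Module.finrank ℝ V3 : ℝ) / 2))) ^ (N + 1), funext fun z => ?_⟩
    by_cases hz : z ∈ D
    · rw [hhdef, Set.indicator_of_mem hz, Set.indicator_of_mem hz, tensorPow]
      have : ∀ i : Fin (N + 1), localGibbsProfile (fun _ => a) (fun _ => u) (fun _ => θ) (z i) =
          (a * ((1 : ℝ) * (2 * Real.pi * θ) ^ (-(Module.finrank ℝ V3 : ℝ) / 2))) *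
            Real.exp (-‖(z i).2 - u‖ ^ 2 / (2 * θ)) := fun i => by
        simp only [localGibbsProfile, localMaxwellian]
        ring
      rw [Finset.prod_congr rfl fun i _ => this i, Finset.prod_mul_distrib, Finset.prod_const, Finset.card_univ,
        Fintype.card_fin]
    · rw [hhdef, Set.indicator_of_notMem hz, Set.indicator_of_notMem hz, mul_zero]
  rw [heq]
  exact E5_lintegral_ofReal_inv_integral_mul_le_one volume hh C

end E5
end FluxClosureEq
end Summit.AtomisticToContinuum.HydrodynamicLimit.Theorems
end
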